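import Literature.NumberTheory.EllipticCurves.HidaOrdinaryCohomologySymPow
import Literature.NumberTheory.EllipticCurves.EichlerShimuraPeriods
import HarnessLib

/-!
# Cocycles of `Γ₀(N)` with coefficients in `Symⁿ`, the Hecke operator `U_p` on them, and Hida's
# contraction onto `Hom(Γ₀(N), ·)` modulo `p`

Second file of the cohomological proof of the deep half of Hida's rank constancy (serving the
named fact `Literature.NumberTheory.EllipticCurves.hida_exists_congruent_ordinary_newform`;
see `HidaOrdinaryCohomologySymPow` for the programme and the references).  For a commutative ring
`R`, a level `N` and a degree `n`:

* `act n M`, the right action `a ↦ Symⁿ(M) a` of an integer matrix `M` on coefficient vectors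
  `a ∈ R^{n+1}` of binary forms of degree `n` (`HidaOrdinaryCohomologySymPow.symPow`), an
  anti-homomorphism (`act_mul`);
* `cocycles n N R`, the `R`-module of **inhomogeneous `1`-cocycles** `u : Γ₀(N) → R^{n+1}`,
  `u(γδ) = u(δ) + u(γ)·δ` — the convention of the tree's Eichler–Shimura period cocycles
  (`EichlerShimuraPeriods.periodFn_mul`: `c(γδ)(p) = c(δ)(p) + c(γ)(δp)`); `cobd n N R v`, the
  coboundary `γ ↦ v·γ - v`;
* `heckeU n N R hp`, **the Hecke operator `U_p = [Γ₀(N) diag(1,p) Γ₀(N)]` on cocycles** for a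
  prime `p`: `(U u)(γ) = ∑ᵢ u(γ'ᵢ)·β_{σ(i)}`, with the representatives `βᵢ`
  (`HeckeOperatorsGamma0Proofs.heckeRep`) and the right action `βᵢ γ = γ'ᵢ β_{σ(i)}` of `Γ₀(N)`
  on them (`EichlerShimuraPeriods.heckePerm`, `heckePermElt`) — Shimura's formula (8.3.2), the one
  the tree proves for the period cocycle of `T_p f` (`periodFn_heckeT`).  It preserves cocycles
  (`heckeU_mem_cocycles`, from the cocycle identities `σ_{γδ} = σ_δ ∘ σ_γ`,
  `(γδ)'ᵢ = γ'ᵢ δ'_{σ_γ(i)}` of the permutation data, `heckePerm_mul`, `heckePermElt_mul`) and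
  coboundaries (`heckeU_cobd`);
* **Hida's contraction** (Hida, *Elementary Modular Iwasawa Theory* (2022), §4.2.11 "Weight
  comparison": the map `i : P(X,Y) ↦ P(1,0)` of (4.40) and the injection `I = i_*` on ordinary
  parts; first in Hida, Ann. Sci. ENS 19 (1986), Thm. 4.4): when `p = 0` in `R`, `p ∣ N` and
  `(p - 1) ∣ n`, the `u^n`-coefficient `proj : cocycles n N R → cocycles 0 N R = Hom(Γ₀(N), R)`
  is `U_p`-equivariant (`proj_heckeU`) and `U_p` kills its kernel (`heckeU_eq_zero_of_proj_eq_zero`);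
  consequently (`finrank_sub_le_of_proj`, over a field) the **non-nilpotent rank** of `U_p` —
  `dim Z¹ - dim (generalised `0`-eigenspace of U_p)` — does not exceed that of `U_p` on
  `Hom(Γ₀(N), R)`.

Everything is proved; no named facts.

## References

* G. Shimura, *Introduction to the arithmetic theory of automorphic functions* (1971), §8.1
  (cocycles), §8.3 ((8.3.2): Hecke operators on cocycles). [Shimura1971]
* H. Hida, *Elementary Modular Iwasawa Theory*, World Scientific 2022, §4.2.11 ((4.40), (4.41),
  Thm. 4.2.24), Lemma 4.1.25, Cor. 4.2.32. [Hida2022EMI]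
* H. Hida, *Iwasawa modules attached to congruences of cusp forms*, Ann. Sci. ENS 19 (1986),
  Thm. 4.4. [Hida1986ENS]
-/

noncomputable section

open scoped MatrixGroups
open CongruenceSubgroup Matrix Module Module.End

namespace Literature.NumberTheory.EllipticCurves.ModularForms.HidaCohomology

/-! ### The action of integer matrices on coefficient vectors -/

/-- The matrix of `γ ∈ Γ₀(N)` as an integer matrix (abbreviation). [folklore] -/
abbrev gmat {N : ℕ} (γ : Gamma0 N) : Matrix (Fin 2) (Fin 2) ℤ := ((γ : SL(2, ℤ)) : Matrix (Fin 2) (Fin 2) ℤ)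

/-- `gmat (γ δ) = gmat γ * gmat δ`. [folklore] -/
theorem gmat_mul {N : ℕ} (γ δ : Gamma0 N) : gmat (γ * δ) = gmat γ * gmat δ := by
  simp [gmat]

/-- `gmat 1 = 1`. [folklore] -/
@[simp] theorem gmat_one {N : ℕ} : gmat (1 : Gamma0 N) = 1 := by simp [gmat]

/-- **The right action of an integer matrix `M` on binary forms of degree `n` over `R`**, in
coefficients: `act n M a = Symⁿ(M) a`, i.e. `F ↦ F(M ·)` on the form `F = evalVec n a`
(`evalVec_act`). [folklore] -/
def act (n : ℕ) {R : Type*} [CommRing R] (M : Matrix (Fin 2) (Fin 2) ℤ) :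
    (Fin (n + 1) → R) →ₗ[R] (Fin (n + 1) → R) :=
  Matrix.toLin' (symPow n (M.map (Int.castRingHom R)))

section Act

variable {n : ℕ} {R : Type*} [CommRing R]

/-- Unfolding `act`. [folklore] -/
theorem act_apply (M : Matrix (Fin 2) (Fin 2) ℤ) (a : Fin (n + 1) → R) :
    act n M a = symPow n (M.map (Int.castRingHom R)) *ᵥ a := by
  rw [act, Matrix.toLin'_apply]

/-- `act` is an anti-homomorphism: `act n (M M') = act n M' ∘ act n M`. [folklore] -/
theorem act_mul (M M' : Matrix (Fin 2) (Fin 2) ℤ) : act n (R := R) (M * M') = act n M' ∘ₗ act n M := by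
  rw [act, act, act, ← Matrix.toLin'_mul, Matrix.map_mul, symPow_mul]

/-- `act n (M M') a = act n M' (act n M a)`. [folklore] -/
theorem act_mul_apply (M M' : Matrix (Fin 2) (Fin 2) ℤ) (a : Fin (n + 1) → R) :
    act n (M * M') a = act n M' (act n M a) := by
  rw [act_mul]; rfl

/-- `act n 1 = id`. [folklore] -/
@[simp] theorem act_one : act n (R := R) 1 = LinearMap.id := by
  rw [act, Matrix.map_one _ (map_zero _) (map_one _), symPow_one, Matrix.toLin'_one]

/-- In degree `0` the action is trivial. [folklore] -/
@[simp] theorem act_zero_eq_id (M : Matrix (Fin 2) (Fin 2) ℤ) : act 0 (R := R) M = LinearMap.id := by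
  rw [act, symPow_zero_eq_one, Matrix.toLin'_one]

/-- The action on forms: `evalVec n (act n M a) p = evalVec n a (M p)`. [folklore] -/
theorem evalVec_act (M : Matrix (Fin 2) (Fin 2) ℤ) (a : Fin (n + 1) → R) (p : Fin 2 → R) :
    evalVec n (act n M a) p = evalVec n a ((M.map (Int.castRingHom R)) *ᵥ p) := by
  rw [act_apply, evalVec_symPow_mulVec]

end Act

/- `act` is made irreducible: all uses go through `act_apply`, `act_mul(_apply)`, `act_one`,
`act_zero_eq_id`, `evalVec_act` (unfolding the symmetric-power matrices inside unification is
prohibitively expensive). -/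
attribute [irreducible] act

/-! ### Cocycles and coboundaries -/

/-- **The `1`-cocycles of `Γ₀(N)` with coefficients in binary forms of degree `n` over `R`**
(right convention, as for the tree's period cocycles): maps `u : Γ₀(N) → R^{n+1}` with
`u(γδ) = u(δ) + u(γ)·δ`. For `n = 0` these are the additive maps `Γ₀(N) → R`.
[cite: Shimura1971, §8.1 (8.1.1)] -/
def cocycles (n N : ℕ) (R : Type*) [CommRing R] : Submodule R (Gamma0 N → Fin (n + 1) → R) where
  carrier := {u | ∀ γ δ : Gamma0 N, u (γ * δ) = u δ + act n (gmat δ) (u γ)}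
  add_mem' := by
    intro u v hu hv γ δ
    simp only [Pi.add_apply, hu γ δ, hv γ δ, map_add]
    abel
  zero_mem' := fun γ δ ↦ by simp
  smul_mem' := by
    intro c u hu γ δ
    simp only [Pi.smul_apply, hu γ δ, smul_add, map_smul]

section Cocycles

variable {n N : ℕ} {R : Type*} [CommRing R]

/-- Unfolding `cocycles`. [folklore] -/
theorem mem_cocycles_iff {u : Gamma0 N → Fin (n + 1) → R} :
    u ∈ cocycles n N R ↔ ∀ γ δ : Gamma0 N, u (γ * δ) = u δ + act n (gmat δ) (u γ) := Iff.rfl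

/-- A cocycle vanishes at `1`. [folklore] -/
theorem cocycle_map_one {u : Gamma0 N → Fin (n + 1) → R} (hu : u ∈ cocycles n N R) : u 1 = 0 := by
  have h := hu 1 1
  rw [mul_one, gmat_one, act_one, LinearMap.id_apply] at h
  have : u 1 + u 1 = u 1 + 0 := by rw [add_zero]; exact h.symm
  exact add_left_cancel this

/-- `u(γ⁻¹) = -u(γ)·γ⁻¹` for a cocycle. [folklore] -/
theorem cocycle_map_inv {u : Gamma0 N → Fin (n + 1) → R} (hu : u ∈ cocycles n N R) (γ : Gamma0 N) :
    u γ⁻¹ = -act n (gmat γ⁻¹) (u γ) := by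
  have h := hu γ γ⁻¹
  rw [mul_inv_cancel, cocycle_map_one hu] at h
  exact eq_neg_of_add_eq_zero_left h.symm

/-- **A cocycle is determined by its values on a generating set**: if it vanishes on a set
generating `Γ₀(N)`, it vanishes. [folklore] -/
theorem cocycle_eq_zero_of_forall_mem {u : Gamma0 N → Fin (n + 1) → R} (hu : u ∈ cocycles n N R)
    {S : Set (Gamma0 N)} (hS : Subgroup.closure S = ⊤) (h : ∀ s ∈ S, u s = 0) : u = 0 := by
  let H : Subgroup (Gamma0 N) :=
    { carrier := {γ | u γ = 0}
      mul_mem' := fun {γ δ} hγ hδ ↦ by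
        change u γ = 0 at hγ
        change u δ = 0 at hδ
        change u (γ * δ) = 0
        rw [hu γ δ, hγ, hδ, map_zero, add_zero]
      one_mem' := cocycle_map_one hu
      inv_mem' := fun {γ} hγ ↦ by
        change u γ = 0 at hγ
        change u γ⁻¹ = 0
        rw [cocycle_map_inv hu γ, hγ, map_zero, neg_zero] }
  have hle : Subgroup.closure S ≤ H := (Subgroup.closure_le H).mpr h
  rw [hS, top_le_iff] at hle
  funext γ
  have : γ ∈ H := hle ▸ Subgroup.mem_top γ
  exact this

end Cocycles

/-- **The coboundary of a vector** `v`: `γ ↦ v·γ - v`. [cite: Shimura1971, §8.1 (8.1.2)] -/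
def cobd (n N : ℕ) (R : Type*) [CommRing R] : (Fin (n + 1) → R) →ₗ[R] cocycles n N R where
  toFun v := ⟨fun γ ↦ act n (gmat γ) v - v, by
    rw [mem_cocycles_iff]
    intro γ δ
    simp only [gmat_mul, act_mul_apply, map_sub]
    abel⟩
  map_add' v w := by
    ext γ i
    simp only [map_add, Submodule.coe_add, Pi.add_apply, Pi.sub_apply]
    ring
  map_smul' c v := by
    ext γ i
    simp only [map_smul, RingHom.id_apply, Submodule.coe_smul, Pi.smul_apply, Pi.sub_apply,
      smul_eq_mul]
    ring

/-- Unfolding `cobd`. [folklore] -/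
@[simp] theorem cobd_apply {n N : ℕ} {R : Type*} [CommRing R] (v : Fin (n + 1) → R) (γ : Gamma0 N) :
    (cobd n N R v : Gamma0 N → Fin (n + 1) → R) γ = act n (gmat γ) v - v := rfl

/-! ### The permutation data of the Hecke cosets: cocycle identities -/

section HeckeData

variable {N p : ℕ} (hp : p.Prime)
include hp

/-- The matrix identity `γ'ᵢ β_{σ(i)} = βᵢ γ` (the tree's `heckePermElt_spec`, restated with
`gmat`). [cite: Shimura1971, §8.3 p. 237] -/
theorem gmat_heckePermElt_mul (γ : Gamma0 N) (i : HeckeIdx N p) :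
    gmat (heckePermElt hp γ i) * heckeRep p (heckePerm hp γ i).1 = heckeRep p i.1 * gmat γ :=
  heckePermElt_spec hp γ i

/-- **The permutations compose**: `σ_{γδ} = σ_δ ∘ σ_γ`. [cite: Shimura1971, §8.3 p. 237] -/
theorem heckePerm_mul (γ δ : Gamma0 N) (i : HeckeIdx N p) :
    heckePerm hp (γ * δ) i = heckePerm hp δ (heckePerm hp γ i) := by
  have hu := existsUnique_heckeRep_mul_coe hp (γ * δ) i
  refine hu.unique ?_ ?_
  · exact ⟨_, coe_mem_delta0_one (heckePermElt hp (γ * δ) i), heckePermElt_spec hp (γ * δ) i⟩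
  · refine ⟨gmat (heckePermElt hp γ i * heckePermElt hp δ (heckePerm hp γ i)),
      coe_mem_delta0_one _, ?_⟩
    rw [gmat_mul, Matrix.mul_assoc, gmat_heckePermElt_mul hp δ, ← Matrix.mul_assoc,
      gmat_heckePermElt_mul hp γ, Matrix.mul_assoc, ← gmat_mul]

/-- **The elements multiply along the permutation**: `(γδ)'ᵢ = γ'ᵢ δ'_{σ_γ(i)}`.
[cite: Shimura1971, §8.3 p. 237] -/
theorem heckePermElt_mul (γ δ : Gamma0 N) (i : HeckeIdx N p) :
    heckePermElt hp (γ * δ) i = heckePermElt hp γ i * heckePermElt hp δ (heckePerm hp γ i) := by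
  have h1 := gmat_heckePermElt_mul hp (γ * δ) i
  rw [heckePerm_mul hp γ δ i] at h1
  have h2 : gmat (heckePermElt hp γ i * heckePermElt hp δ (heckePerm hp γ i)) *
      heckeRep p (heckePerm hp δ (heckePerm hp γ i)).1 = heckeRep p i.1 * gmat (γ * δ) := by
    rw [gmat_mul, Matrix.mul_assoc, gmat_heckePermElt_mul hp δ, ← Matrix.mul_assoc,
      gmat_heckePermElt_mul hp γ, Matrix.mul_assoc, ← gmat_mul]
  have h3 := h1.trans h2.symm
  have hdet : (heckeRep p (heckePerm hp δ (heckePerm hp γ i)).1).det ≠ 0 :=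
    det_heckeRep_ne_zero hp.ne_zero _
  have h4 := matrix_mul_right_cancel_of_det_ne_zero hdet h3
  exact Subtype.ext (Matrix.SpecialLinearGroup.ext _ _ fun a b ↦ congrFun (congrFun h4 a) b)

end HeckeData

/-! ### The Hecke operator `U_p` on cocycles -/

/-- **The Hecke operator `T_p = [Γ₀(N) diag(1,p) Γ₀(N)]` on functions `Γ₀(N) → R^{n+1}`**
(`U_p` when `p ∣ N`): `(U u)(γ) = ∑ᵢ u(γ'ᵢ)·β_{σ(i)}`, Shimura's formula (8.3.2) — the formula the
tree proves for the period cocycle of `T_p f` (`EichlerShimuraPeriods.periodFn_heckeT`).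
[cite: Shimura1971, §8.3 (8.3.2)] -/
def heckeU (n N : ℕ) (R : Type*) [CommRing R] {p : ℕ} [NeZero p] (hp : p.Prime) :
    (Gamma0 N → Fin (n + 1) → R) →ₗ[R] (Gamma0 N → Fin (n + 1) → R) where
  toFun u γ := ∑ i : HeckeIdx N p, act n (heckeRep p (heckePerm hp γ i).1) (u (heckePermElt hp γ i))
  map_add' u v := by
    funext γ
    simp only [Pi.add_apply, map_add, Finset.sum_add_distrib]
  map_smul' c u := by
    funext γ
    simp only [Pi.smul_apply, map_smul, RingHom.id_apply, Finset.smul_sum]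

section Hecke

variable {n N : ℕ} {R : Type*} [CommRing R] {p : ℕ} [NeZero p] (hp : p.Prime)

/-- Unfolding `heckeU`. [folklore] -/
theorem heckeU_apply (u : Gamma0 N → Fin (n + 1) → R) (γ : Gamma0 N) :
    heckeU n N R hp u γ =
      ∑ i : HeckeIdx N p, act n (heckeRep p (heckePerm hp γ i).1) (u (heckePermElt hp γ i)) := rfl

/-- **`U_p` preserves cocycles.** [cite: Shimura1971, §8.3 Prop. 8.5] -/
theorem heckeU_mem_cocycles {u : Gamma0 N → Fin (n + 1) → R} (hu : u ∈ cocycles n N R) :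
    heckeU n N R hp u ∈ cocycles n N R := by
  rw [mem_cocycles_iff] at hu ⊢
  intro γ δ
  rw [heckeU_apply, heckeU_apply, heckeU_apply, map_sum]
  -- expand `u((γδ)'ᵢ)` by the cocycle relation
  have hterm : ∀ i : HeckeIdx N p,
      act n (heckeRep p (heckePerm hp (γ * δ) i).1) (u (heckePermElt hp (γ * δ) i)) =
        act n (heckeRep p (heckePerm hp δ (heckePerm hp γ i)).1)
            (u (heckePermElt hp δ (heckePerm hp γ i))) +
          act n (gmat δ) (act n (heckeRep p (heckePerm hp γ i).1) (u (heckePermElt hp γ i))) := by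
    intro i
    have e1 := heckePerm_mul hp γ δ i
    have e2 := heckePermElt_mul hp γ δ i
    have e3 := hu (heckePermElt hp γ i) (heckePermElt hp δ (heckePerm hp γ i))
    have e4 : act n (heckeRep p (heckePerm hp δ (heckePerm hp γ i)).1)
        (act n (gmat (heckePermElt hp δ (heckePerm hp γ i))) (u (heckePermElt hp γ i))) =
        act n (gmat δ) (act n (heckeRep p (heckePerm hp γ i).1) (u (heckePermElt hp γ i))) := by
      simp only [← act_mul_apply, gmat_heckePermElt_mul hp δ]
    simp only [e1, e2, e3, map_add, e4]
  rw [Finset.sum_congr rfl fun i _ ↦ hterm i, Finset.sum_add_distrib, add_left_inj]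
  -- reindex the first sum along the bijection `σ_γ`
  exact Finset.sum_equiv (heckePermEquiv hp γ) (fun i ↦ by simp) (fun i _ ↦ by
    rw [heckePermEquiv_apply])

variable (n N R) in
/-- **`U_p` on the module of cocycles.** [cite: Shimura1971, §8.3 Prop. 8.5] -/
def heckeUZ : Module.End R (cocycles n N R) :=
  (heckeU n N R hp).restrict fun _ hu ↦ heckeU_mem_cocycles hp hu

/-- Unfolding `heckeUZ`. [folklore] -/
@[simp] theorem coe_heckeUZ (u : cocycles n N R) :
    ((heckeUZ n N R hp u : cocycles n N R) : Gamma0 N → Fin (n + 1) → R) = heckeU n N R hp u := rfl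

/-- **`U_p` on coboundaries**: `U(δv) = δ(∑ᵢ v·βᵢ)`. [cite: Shimura1971, §8.3] -/
theorem heckeUZ_cobd (v : Fin (n + 1) → R) :
    heckeUZ n N R hp (cobd n N R v) = cobd n N R (∑ i : HeckeIdx N p, act n (heckeRep p i.1) v) := by
  apply Subtype.ext
  funext γ
  rw [coe_heckeUZ, heckeU_apply, cobd_apply, map_sum]
  simp only [cobd_apply, map_sub, Finset.sum_sub_distrib]
  -- the first sums agree termwise: `(v·γ'ᵢ)·β_{σ(i)} = (v·βᵢ)·γ`
  have h1 : ∀ i : HeckeIdx N p, act n (heckeRep p (heckePerm hp γ i).1) (act n (gmat (heckePermElt hp γ i)) v) =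
      act n (gmat γ) (act n (heckeRep p i.1) v) := fun i ↦ by
    simp only [← act_mul_apply, gmat_heckePermElt_mul hp γ]
  -- the second sums agree after reindexing along `σ_γ`
  have h2 : ∑ i : HeckeIdx N p, act n (heckeRep p (heckePerm hp γ i).1) v =
      ∑ i : HeckeIdx N p, act n (heckeRep p i.1) v :=
    Finset.sum_equiv (heckePermEquiv hp γ) (fun i ↦ by simp) (fun i _ ↦ by rw [heckePermEquiv_apply])
  rw [Finset.sum_congr rfl fun i _ ↦ h1 i, h2]

/-- Powers of `U_p` on cocycles are computed on the underlying functions. [folklore] -/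
theorem coe_heckeUZ_pow (u : cocycles n N R) (m : ℕ) :
    (((heckeUZ n N R hp ^ m) u : cocycles n N R) : Gamma0 N → Fin (n + 1) → R) =
      (heckeU n N R hp ^ m) u := by
  induction m with
  | zero => simp
  | succ m ih =>
    rw [pow_succ', pow_succ', Module.End.mul_apply, Module.End.mul_apply, coe_heckeUZ, ← ih]

end Hecke

/-! ### Hida's contraction onto the `u^n`-coefficient -/

section Contraction

variable {n N : ℕ} {R : Type*} [CommRing R] {p : ℕ} (hp : p.Prime)
include hp

/-- Fermat: for an integer `a` prime to `p` and `(p - 1) ∣ n`, `a^n = 1` in any ring in which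
`p = 0`. [folklore] -/
theorem intCast_pow_eq_one_of_charP (hpR : (p : R) = 0) {a : ℤ} (ha : IsCoprime a p) (hn : (p - 1) ∣ n) :
    ((a : R)) ^ n = 1 := by
  obtain ⟨m, rfl⟩ := hn
  have hF : (a : ZMod p) ^ (p - 1) = 1 := by
    haveI : Fact p.Prime := ⟨hp⟩
    apply ZMod.pow_card_sub_one_eq_one
    intro h0
    rw [ZMod.intCast_zmod_eq_zero_iff_dvd] at h0
    have h2 : (p : ℤ) ∣ 1 := by
      obtain ⟨x, y, hxy⟩ := ha
      have : (p : ℤ) ∣ x * a + y * p := dvd_add (dvd_mul_of_dvd_right h0 x) (dvd_mul_left _ _)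
      rwa [hxy] at this
    exact hp.not_dvd_one (by exact_mod_cast h2)
  -- lift `a^(p-1) ≡ 1 (mod p)` to `R`
  have hdvd : (p : ℤ) ∣ a ^ (p - 1) - 1 := by
    rw [← ZMod.intCast_zmod_eq_zero_iff_dvd]
    push_cast
    rw [hF, sub_self]
  obtain ⟨c, hc⟩ := hdvd
  have hR : ((a : R)) ^ (p - 1) = 1 := by
    have : ((a ^ (p - 1) - 1 : ℤ) : R) = ((p * c : ℤ) : R) := by rw [hc]
    push_cast at this
    rw [hpR, zero_mul, sub_eq_zero] at this
    exact this
  rw [pow_mul, hR, one_pow]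

omit hp in
/-- The lower-left entry of `γ ∈ Γ₀(N)` is divisible by `p` when `p ∣ N`. [folklore] -/
theorem dvd_gmat_one_zero (hpN : p ∣ N) (γ : Gamma0 N) : (p : ℤ) ∣ gmat γ 1 0 := by
  have h : ((gmat γ 1 0 : ℤ) : ZMod N) = 0 := by
    have := γ.2
    rw [Gamma0_mem] at this
    exact this
  rw [ZMod.intCast_zmod_eq_zero_iff_dvd] at h
  exact (Int.natCast_dvd_natCast.mpr hpN).trans h

omit hp in
/-- The upper-left entry of `γ ∈ Γ₀(N)` is prime to `p` when `p ∣ N`. [folklore] -/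
theorem isCoprime_gmat_zero_zero (hpN : p ∣ N) (γ : Gamma0 N) : IsCoprime (gmat γ 0 0) p := by
  have hdet := Matrix.det_fin_two (gmat γ)
  rw [Matrix.SpecialLinearGroup.det_coe] at hdet
  obtain ⟨c, hc⟩ := dvd_gmat_one_zero hpN γ
  refine ⟨gmat γ 1 1, -(gmat γ 0 1 * c), ?_⟩
  rw [hc] at hdet
  linear_combination -hdet

/-- **The `u^n`-coefficient is `Γ₀(N)`-invariant modulo `p`** (`p ∣ N`, `(p-1) ∣ n`, `p = 0` in
`R`): `(u·γ)₀ = u₀`. [cite: Hida2022EMI, §4.2.11 (4.40) and the injection `I = i_*`] -/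
theorem act_gamma_apply_zero (hpR : (p : R) = 0) (hpN : p ∣ N) (hn : (p - 1) ∣ n) (γ : Gamma0 N)
    (a : Fin (n + 1) → R) : act n (gmat γ) a 0 = a 0 := by
  have hc : ((gmat γ).map (Int.castRingHom R)) 1 0 = 0 := by
    rw [Matrix.map_apply]
    obtain ⟨c, hc⟩ := dvd_gmat_one_zero hpN γ
    simp [hc, hpR]
  rw [act_apply, symPow_mulVec_apply_zero hc, Matrix.map_apply]
  simp only [Int.coe_castRingHom]
  rw [intCast_pow_eq_one_of_charP hp hpR (isCoprime_gmat_zero_zero hpN γ) hn, one_mul]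

/-- For `p ∣ N` every Hecke index is finite: `βᵢ = (1 j; 0 p)`. [folklore] -/
theorem heckeRep_eq_of_dvd (hpN : p ∣ N) (i : HeckeIdx N p) :
    ∃ j : ZMod p, i.1 = some j := by
  have _ := hp
  obtain ⟨i, hi⟩ := i
  cases i with
  | none => exact absurd hpN (hi rfl)
  | some j => exact ⟨j, rfl⟩

/-- **The Hecke representatives contract modulo `p`**: for `p ∣ N` and `p = 0` in `R`,
`a·βᵢ = a₀ • wᵢ` for an explicit vector `wᵢ` with `(wᵢ)₀ = 1`. [cite: Hida2022EMI, §4.2.11 (4.40) and the injection `I = i_*`] -/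
theorem act_heckeRep_eq_smul (hpR : (p : R) = 0) (hpN : p ∣ N) (i : HeckeIdx N p) (a : Fin (n + 1) → R) :
    ∃ w : Fin (n + 1) → R, w 0 = 1 ∧ act n (heckeRep p i.1) a = a 0 • w := by
  obtain ⟨j, hj⟩ := heckeRep_eq_of_dvd hp hpN i
  set M : Matrix (Fin 2) (Fin 2) R := (heckeRep p i.1).map (Int.castRingHom R) with hM
  have h10 : M 1 0 = 0 := by simp [hM, hj, heckeRep]
  have h11 : M 1 1 = 0 := by simp [hM, hj, heckeRep, hpR]
  have h00 : M 0 0 = 1 := by simp [hM, hj, heckeRep]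
  refine ⟨fun k ↦ (n.choose k : R) * M 0 0 ^ (n - k) * M 0 1 ^ (k : ℕ), by simp [h00], ?_⟩
  rw [act_apply, ← hM, symPow_mulVec_of_row_one_eq_zero h10 h11]

/-- The `u^n`-coefficient is fixed by the Hecke representatives modulo `p`. [cite: Hida2022EMI, §4.2.11] -/
theorem act_heckeRep_apply_zero (hpR : (p : R) = 0) (hpN : p ∣ N) (i : HeckeIdx N p)
    (a : Fin (n + 1) → R) : act n (heckeRep p i.1) a 0 = a 0 := by
  obtain ⟨w, hw0, hw⟩ := act_heckeRep_eq_smul (n := n) hp hpR hpN i a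
  rw [hw, Pi.smul_apply, hw0, smul_eq_mul, mul_one]

/-- The Hecke representatives kill, modulo `p`, the forms with vanishing `u^n`-coefficient.
[cite: Hida2022EMI, §4.2.11] -/
theorem act_heckeRep_eq_zero (hpR : (p : R) = 0) (hpN : p ∣ N) (i : HeckeIdx N p)
    {a : Fin (n + 1) → R} (ha : a 0 = 0) : act n (heckeRep p i.1) a = 0 := by
  obtain ⟨w, -, hw⟩ := act_heckeRep_eq_smul (n := n) hp hpR hpN i a
  rw [hw, ha, zero_smul]

/-- The `u^n`-coefficient of a cocycle is additive (`p ∣ N`, `(p-1) ∣ n`, `p = 0` in `R`).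
[cite: Hida2022EMI, §4.2.11 (4.40) and the injection `I = i_*`] -/
theorem proj_mem (hpR : (p : R) = 0) (hpN : p ∣ N) (hn : (p - 1) ∣ n) (u : cocycles n N R) :
    (fun (γ : Gamma0 N) (_ : Fin 1) ↦ (u : Gamma0 N → Fin (n + 1) → R) γ 0) ∈ cocycles 0 N R := by
  rw [mem_cocycles_iff]
  intro γ δ
  funext k
  have hu := (mem_cocycles_iff.mp u.2) γ δ
  simp only [act_zero_eq_id, LinearMap.id_apply, Pi.add_apply, hu, act_gamma_apply_zero hp hpR hpN hn]

omit hp in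
variable (n N R) in
/-- **The `u^n`-coefficient of a cocycle is an additive map `Γ₀(N) → R`** (a cocycle of degree
`0`) when `p ∣ N`, `(p-1) ∣ n` and `p = 0` in `R`: Hida's contraction map
`Z¹(Γ₀(N), Symⁿ) → Hom(Γ₀(N), R)`. [cite: Hida2022EMI, §4.2.11 (4.40) and the injection `I = i_*`] -/
def proj (hp : p.Prime) (hpR : (p : R) = 0) (hpN : p ∣ N) (hn : (p - 1) ∣ n) :
    cocycles n N R →ₗ[R] cocycles 0 N R where
  toFun u := ⟨fun γ _ ↦ (u : Gamma0 N → Fin (n + 1) → R) γ 0, proj_mem hp hpR hpN hn u⟩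
  map_add' u v := by ext; rfl
  map_smul' c u := by ext; rfl

/-- Unfolding `proj`. [folklore] -/
@[simp] theorem proj_apply (hpR : (p : R) = 0) (hpN : p ∣ N) (hn : (p - 1) ∣ n) (u : cocycles n N R)
    (γ : Gamma0 N) (k : Fin 1) :
    (proj n N R hp hpR hpN hn u : Gamma0 N → Fin 1 → R) γ k = (u : Gamma0 N → Fin (n + 1) → R) γ 0 := rfl

variable [NeZero p]

/-- **The contraction map is `U_p`-equivariant.** [cite: Hida2022EMI, §4.2.11 (4.40) and the injection `I = i_*`] -/
theorem proj_heckeUZ (hpR : (p : R) = 0) (hpN : p ∣ N) (hn : (p - 1) ∣ n) (u : cocycles n N R) :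
    proj n N R hp hpR hpN hn (heckeUZ n N R hp u) = heckeUZ 0 N R hp (proj n N R hp hpR hpN hn u) := by
  apply Subtype.ext
  funext γ k
  rw [proj_apply, coe_heckeUZ, heckeU_apply, coe_heckeUZ, heckeU_apply, Finset.sum_apply,
    Finset.sum_apply]
  refine Finset.sum_congr rfl fun i _ ↦ ?_
  rw [act_heckeRep_apply_zero hp hpR hpN (heckePerm hp γ i), act_zero_eq_id, LinearMap.id_apply,
    proj_apply]

/-- **`U_p` kills the kernel of the contraction map.** [cite: Hida2022EMI, §4.2.11 (4.40) and the injection `I = i_*`] -/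
theorem heckeUZ_eq_zero_of_proj_eq_zero (hpR : (p : R) = 0) (hpN : p ∣ N) (hn : (p - 1) ∣ n)
    {u : cocycles n N R} (hu : proj n N R hp hpR hpN hn u = 0) : heckeUZ n N R hp u = 0 := by
  apply Subtype.ext
  funext γ
  rw [coe_heckeUZ, heckeU_apply, Submodule.coe_zero, Pi.zero_apply]
  refine Finset.sum_eq_zero fun i _ ↦ act_heckeRep_eq_zero hp hpR hpN (heckePerm hp γ i) ?_
  have := congrArg (fun v : cocycles 0 N R ↦ (v : Gamma0 N → Fin 1 → R) (heckePermElt hp γ i) 0) hu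
  simpa using this

end Contraction

/-! ### The non-nilpotent rank does not increase under the contraction -/

section Rank

variable {K : Type*} [Field K] {V W : Type*} [AddCommGroup V] [Module K V] [AddCommGroup W]
  [Module K W] [FiniteDimensional K V] [FiniteDimensional K W]

/-- **Linear algebra of the contraction**: if `f : V → W` intertwines `A` with `B` and `A` kills
`ker f`, then `dim V - dim V₀(A) ≤ dim W - dim W₀(B)` for the generalised `0`-eigenspaces: the
non-nilpotent part of `A` embeds into that of `B`. [folklore] -/
theorem finrank_sub_finrank_maxGenEigenspace_zero_le (f : V →ₗ[K] W) (A : Module.End K V)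
    (B : Module.End K W) (hAB : ∀ v, f (A v) = B (f v)) (hker : ∀ v, f v = 0 → A v = 0) :
    finrank K V - finrank K (A.maxGenEigenspace 0) ≤ finrank K W - finrank K (B.maxGenEigenspace 0) := by
  -- the preimage of `W₀(B)` is `V₀(A)`
  have hpow : ∀ (m : ℕ) (v : V), f ((A ^ m) v) = (B ^ m) (f v) := by
    intro m
    induction m with
    | zero => intro v; simp
    | succ m ih => intro v; rw [pow_succ, pow_succ, Module.End.mul_apply, Module.End.mul_apply, ih, hAB]
  have hpre : (B.maxGenEigenspace 0).comap f ≤ A.maxGenEigenspace 0 := by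
    intro v hv
    rw [Submodule.mem_comap, Module.End.mem_maxGenEigenspace] at hv
    obtain ⟨m, hm⟩ := hv
    rw [zero_smul, sub_zero] at hm
    rw [Module.End.mem_maxGenEigenspace]
    refine ⟨m + 1, ?_⟩
    rw [zero_smul, sub_zero, pow_succ', Module.End.mul_apply]
    apply hker
    rw [hpow, hm]
  -- hence `V / V₀(A)` embeds into `W / W₀(B)`
  let g : V ⧸ A.maxGenEigenspace 0 →ₗ[K] W ⧸ B.maxGenEigenspace 0 :=
    (A.maxGenEigenspace 0).liftQ ((B.maxGenEigenspace 0).mkQ ∘ₗ f) (by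
      intro v hv
      rw [LinearMap.mem_ker, LinearMap.comp_apply, Submodule.mkQ_apply, Submodule.Quotient.mk_eq_zero,
        Module.End.mem_maxGenEigenspace]
      rw [Module.End.mem_maxGenEigenspace] at hv
      obtain ⟨m, hm⟩ := hv
      refine ⟨m, ?_⟩
      rw [zero_smul, sub_zero] at hm ⊢
      rw [← hpow, hm, map_zero])
  have hg : Function.Injective g := by
    rw [← LinearMap.ker_eq_bot, eq_bot_iff]
    intro x hx
    induction x using Submodule.Quotient.induction_on with
    | H v =>
      rw [LinearMap.mem_ker] at hx
      change (B.maxGenEigenspace 0).mkQ (f v) = 0 at hx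
      rw [Submodule.mkQ_apply, Submodule.Quotient.mk_eq_zero] at hx
      rw [Submodule.mem_bot, Submodule.Quotient.mk_eq_zero]
      exact hpre hx
  have h1 := LinearMap.finrank_le_finrank_of_injective hg
  rw [Submodule.finrank_quotient, Submodule.finrank_quotient] at h1
  exact h1

end Rank

/-- **Hida's contraction inequality** (over a field `K` of characteristic `p`, for `p ∣ N` and
`(p - 1) ∣ n`): the non-nilpotent rank of `U_p` on `Z¹(Γ₀(N), Symⁿ(K²))` is at most that of
`U_p` on `Hom(Γ₀(N), K)`:
`dim Z¹ₙ - dim (Z¹ₙ)₀(U_p) ≤ dim Z¹₀ - dim (Z¹₀)₀(U_p)`. This is the mechanism of Hida's control of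
the ordinary part in the weight direction. [cite: Hida2022EMI, §4.2.11 (the injection `I = i_*`)] [cite: Hida2022EMI, Cor. 4.2.32] -/
theorem finrank_sub_le_of_proj {n N : ℕ} {K : Type*} [Field K] {p : ℕ} [NeZero p] (hp : p.Prime)
    (hpK : (p : K) = 0) (hpN : p ∣ N) (hn : (p - 1) ∣ n) [FiniteDimensional K (cocycles n N K)]
    [FiniteDimensional K (cocycles 0 N K)] :
    finrank K (cocycles n N K) - finrank K ((heckeUZ n N K hp).maxGenEigenspace 0) ≤
      finrank K (cocycles 0 N K) - finrank K ((heckeUZ 0 N K hp).maxGenEigenspace 0) :=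
  finrank_sub_finrank_maxGenEigenspace_zero_le (proj n N K hp hpK hpN hn) _ _
    (proj_heckeUZ hp hpK hpN hn) fun _ hu ↦ heckeUZ_eq_zero_of_proj_eq_zero hp hpK hpN hn hu

end Literature.NumberTheory.EllipticCurves.ModularForms.HidaCohomology
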